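import Summits.NavierStokesRegularity.NavierStokesRegularity.Theorems.ExtremiserTransienceBangBangCoreDefs
import Summits.NavierStokesRegularity.NavierStokesRegularity.Theorems.ExtremiserTransienceKStarAttainedPerturbation
import Literature.Analysis.FluidPDE.AxisymNoSwirlTaoBounds
import Literature.Analysis.FluidPDE.VorticityCalculus
import Mathlib.Analysis.Real.Sqrt
import HarnessLib

/-!
# Route `ExtremiserTransience`, crux `RegularisedNearPlateauStability` (stmt-NavierStokesRegularity-28317):
# the «NO-DUD LAW» (quantitative height equalisation for separated cells) PROVED

`--supports stmt-NavierStokesRegularity-28317` (helper).  Author: prover seat `ns-net-p2` (g3).  The statement is the typed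
SUPPORT statement `NoDudLaw` of LINE g8-α «sparse bang-bang», §3d of the crux workfile
`Cruxes/NearExtremalTransiencePerFlow/Lines/sparse_bangbang.lean` (ns-idea-5 g8; critic of record idea-crit-4 g6, read-back
2026-08-28T23:35:17Z), VERBATIM with `IsAdm` = the Theorems-side text of record `DepletionLadder.KStar.BangBang.IsAdm`:

if a near-extremal field `Σᵢ wᵢ` (`(κ⋆−ε)·M·√Z·√W ≤ |J|`) is a finite sum of admissible pieces with pairwise disjoint
topological supports and heights `Mᵢ ≤ M`, then the `√(ZᵢWᵢ)`-mass of the pieces of height `≤ (1−δ)M` («duds») is at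
most `ε/(κ⋆δ)·√Z·√W`.

Proof (S-size, as sketched in the workfile): `J, Z, W` are ADDITIVE over pairwise disjoint `tsupport`s — at every point
at most one piece is non-zero together with all its derivatives (`KStar.vanish_of_notMem_tsupport`), so every cross term
of the pointwise densities vanishes (`apply_sum_eq_sum_of_pairwise`); per piece `|Jᵢ| ≤ κ⋆·Mᵢ·√Zᵢ·√Wᵢ`
(`DepletionLadder.sharpDepletion_is_universal`); Cauchy–Schwarz `Σ√Zᵢ√Wᵢ ≤ √Z√W` (`Real.sum_sqrt_mul_sqrt_le`); hence
`(κ⋆−ε)MG ≤ |J| ≤ κ⋆(MG − δM·D)`, i.e. `κ⋆δ·D ≤ ε·G`.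
HONEST FRAMING: an elementary inequality about the depletion functional on finite disjoint families; it is not in the
chain of any line; 28317, 26567 and NS regularity remain OPEN; no summit is proved by a line. [folklore]
-/

noncomputable section

open scoped InnerProductSpace RealInnerProductSpace ENNReal ContDiff
open MeasureTheory Set
open Literature.Analysis.FluidPDE
open Summit.NavierStokesRegularity.NavierStokesRegularity.Theorems.DepletionLadder.KStar
open Summit.NavierStokesRegularity.NavierStokesRegularity.Theorems.DepletionLadder.KStar.HalfSpace

namespace Summit.NavierStokesRegularity.NavierStokesRegularity.Theorems

-- the problem directory repeats the summit name (`NavierStokesRegularity/NavierStokesRegularity`)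
set_option linter.dupNamespace false

namespace DepletionLadder.KStar.BangBang

/-- If at most one term of a finite family is non-zero, every function vanishing at `0` is additive on it:
`f (Σᵢ aᵢ) = Σᵢ f aᵢ`. [folklore] -/
theorem apply_sum_eq_sum_of_pairwise {ι V N : Type*} [AddCommMonoid V] [AddCommMonoid N] (s : Finset ι)
    (a : ι → V) (f : V → N) (hf : f 0 = 0) (h : ∀ i ∈ s, ∀ j ∈ s, i ≠ j → a i = 0 ∨ a j = 0) :
    f (∑ i ∈ s, a i) = ∑ i ∈ s, f (a i) := by
  by_cases hex : ∃ i ∈ s, a i ≠ 0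
  · obtain ⟨i₀, hi₀, hne⟩ := hex
    have hz : ∀ j ∈ s, j ≠ i₀ → a j = 0 := fun j hj hji =>
      (h j hj i₀ hi₀ hji).resolve_right hne
    rw [Finset.sum_eq_single_of_mem i₀ hi₀ hz,
      Finset.sum_eq_single_of_mem i₀ hi₀ (fun j hj hji => by rw [hz j hj hji, hf])]
  · push Not at hex
    rw [Finset.sum_eq_zero hex, hf, Finset.sum_eq_zero (fun j hj => by rw [hex j hj, hf])]

variable {n : ℕ} {w : Fin n → E3 → E3} {Mi : Fin n → ℝ} {B : ℝ}

/-- Pointwise: off `tsupport (w i)` the piece, its curl, its derivative and the derivative of its curl vanish; two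
pieces with disjoint supports cannot both be «on» at a point. [folklore] -/
theorem pairwise_vanish (hdisj : ∀ i j, i ≠ j → Disjoint (tsupport (w i)) (tsupport (w j)))
    (x : E3) {i j : Fin n} (hij : i ≠ j) :
    (curl (w i) x = 0 ∧ fderiv ℝ (w i) x = 0 ∧ fderiv ℝ (curl (w i)) x = 0) ∨
      (curl (w j) x = 0 ∧ fderiv ℝ (w j) x = 0 ∧ fderiv ℝ (curl (w j)) x = 0) := by
  by_cases hx : x ∈ tsupport (w i)
  · right
    have hxj : x ∉ tsupport (w j) := Set.disjoint_left.1 (hdisj i j hij) hx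
    exact (vanish_of_notMem_tsupport (φ := w j) hxj).2
  · left
    exact (vanish_of_notMem_tsupport (φ := w i) hx).2

/-- The sum field as a function. [folklore] -/
theorem sum_fn_eq : (∑ i, w i) = fun x => ∑ i, w i x := by
  ext x
  simp [Finset.sum_apply]

/-- `curl (Σ wᵢ) = Σ curl wᵢ` pointwise, for differentiable pieces. [folklore] -/
theorem curl_sum_eq (hw : ∀ i, ContDiff ℝ (⊤ : ℕ∞) (w i)) (x : E3) :
    curl (∑ i, w i) x = ∑ i, curl (w i) x := by
  rw [sum_fn_eq, curl_eq_curlCLM, fderiv_fun_sum (fun i _ => ((hw i).differentiable (by simp)).differentiableAt),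
    map_sum]
  rfl

/-- `D(Σ wᵢ) = Σ Dwᵢ` pointwise. [folklore] -/
theorem fderiv_sum_eq (hw : ∀ i, ContDiff ℝ (⊤ : ℕ∞) (w i)) (x : E3) :
    fderiv ℝ (∑ i, w i) x = ∑ i, fderiv ℝ (w i) x := by
  rw [sum_fn_eq, fderiv_fun_sum (fun i _ => ((hw i).differentiable (by simp)).differentiableAt)]

/-- `D(curl Σ wᵢ) = Σ D(curl wᵢ)` pointwise. [folklore] -/
theorem fderiv_curl_sum_eq (hw : ∀ i, ContDiff ℝ (⊤ : ℕ∞) (w i)) (x : E3) :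
    fderiv ℝ (curl (∑ i, w i)) x = ∑ i, fderiv ℝ (curl (w i)) x := by
  have hfun : curl (∑ i, w i) = fun y => ∑ i, curl (w i) y := funext (curl_sum_eq hw)
  rw [hfun, fderiv_fun_sum]
  intro i _
  have h1 : ContDiff ℝ 1 (curl (w i)) := contDiff_curl (n := 1) ((hw i).of_le (by norm_cast))
  exact (h1.differentiable one_ne_zero).differentiableAt

/-- **Additivity of the enstrophy** over pairwise disjoint supports: `Z(Σ wᵢ) = Σ Z(wᵢ)`. [folklore] -/
theorem zen_sum_eq (hadm : ∀ i, IsAdm (w i) (Mi i) B)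
    (hdisj : ∀ i j, i ≠ j → Disjoint (tsupport (w i)) (tsupport (w j))) :
    Zen (∑ i, w i) = ∑ i, Zen (w i) := by
  have hw : ∀ i, ContDiff ℝ (⊤ : ℕ∞) (w i) := fun i => (hadm i).1
  unfold Zen
  rw [← integral_finsetSum]
  · refine integral_congr_ae (ae_of_all _ fun x => ?_)
    beta_reduce
    rw [curl_sum_eq hw x]
    exact apply_sum_eq_sum_of_pairwise _ (fun i => curl (w i) x) (fun c => ‖c‖ ^ 2) (by simp)
      (fun i _ j _ hij => ((pairwise_vanish hdisj x hij).imp (fun h => h.1) (fun h => h.1)))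
  · intro i _
    exact (integrable_norm_curl_sq ((hw i).of_le (by norm_cast)) (hadm i).2.2.2.2.2.1).1

/-- **Additivity of the palinstrophy** over pairwise disjoint supports: `W(Σ wᵢ) = Σ W(wᵢ)`. [folklore] -/
theorem wpa_sum_eq (hadm : ∀ i, IsAdm (w i) (Mi i) B)
    (hdisj : ∀ i j, i ≠ j → Disjoint (tsupport (w i)) (tsupport (w j))) :
    Wpa (∑ i, w i) = ∑ i, Wpa (w i) := by
  have hw : ∀ i, ContDiff ℝ (⊤ : ℕ∞) (w i) := fun i => (hadm i).1
  unfold Wpa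
  rw [← integral_finsetSum]
  · refine integral_congr_ae (ae_of_all _ fun x => ?_)
    beta_reduce
    rw [fderiv_curl_sum_eq hw x]
    exact apply_sum_eq_sum_of_pairwise _ (fun i => fderiv ℝ (curl (w i)) x) (fun A => frobeniusNormSq A)
      (by simp) (fun i _ j _ hij => ((pairwise_vanish hdisj x hij).imp (fun h => h.2.2) (fun h => h.2.2)))
  · intro i _
    exact (integrable_frobeniusNormSq_fderiv_curl ((hw i).of_le (by norm_cast)) (hadm i).2.2.2.2.2.2).1

/-- **Additivity of the stretching integral** over pairwise disjoint supports: `J(Σ wᵢ) = Σ J(wᵢ)`. [folklore] -/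
theorem jst_sum_eq (hadm : ∀ i, IsAdm (w i) (Mi i) B)
    (hdisj : ∀ i j, i ≠ j → Disjoint (tsupport (w i)) (tsupport (w j))) :
    Jst (∑ i, w i) = ∑ i, Jst (w i) := by
  have hw : ∀ i, ContDiff ℝ (⊤ : ℕ∞) (w i) := fun i => (hadm i).1
  unfold Jst
  rw [← integral_finsetSum]
  · refine integral_congr_ae (ae_of_all _ fun x => ?_)
    beta_reduce
    rw [curl_sum_eq hw x, fderiv_sum_eq hw x]
    -- the family of pairs `(curl wᵢ x, Dwᵢ x)`, of which at most one is non-zero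
    have h := apply_sum_eq_sum_of_pairwise Finset.univ (fun i => (curl (w i) x, fderiv ℝ (w i) x))
      (fun p : E3 × (E3 →L[ℝ] E3) => ⟪p.1, p.2 p.1⟫_ℝ) (by simp)
      (fun i _ j _ hij => ((pairwise_vanish hdisj x hij).imp
        (fun h => Prod.ext h.1 h.2.1) (fun h => Prod.ext h.1 h.2.1)))
    simpa [Prod.fst_sum, Prod.snd_sum] using h
  · intro i _
    exact integrable_stretching (v := w i) (hw i) (hadm i).2.2.2.1 (hadm i).2.2.2.2.2.1

/-- **The «no-dud law»** (typed support statement `NoDudLaw` of LINE g8-α, §3d of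
`Cruxes/NearExtremalTransiencePerFlow/Lines/sparse_bangbang.lean`, verbatim with `IsAdm` the Theorems-side text): for a
near-extremal finite sum of admissible pieces with pairwise disjoint `tsupport`s and heights `Mᵢ ≤ M`, the `√(ZᵢWᵢ)`-mass of
the pieces of height `≤ (1−δ)M` is `≤ ε/(κ⋆δ)·√Z·√W`. [folklore] -/
theorem noDudLaw :
    ∀ (n : ℕ) (w : Fin n → E3 → E3) (Mi : Fin n → ℝ) (M B ε δ : ℝ),
      0 < M → 0 < ε → 0 < δ →
      (∀ i, IsAdm (w i) (Mi i) B) → (∀ i, Mi i ≤ M) →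
      (∀ i j, i ≠ j → Disjoint (tsupport (w i)) (tsupport (w j))) →
      (kStar - ε) * M * Real.sqrt (Zen (∑ i, w i)) * Real.sqrt (Wpa (∑ i, w i)) ≤ |Jst (∑ i, w i)| →
        (∑ i ∈ Finset.univ.filter (fun i => Mi i ≤ (1 - δ) * M), Real.sqrt (Zen (w i) * Wpa (w i)))
          ≤ ε / (kStar * δ) * (Real.sqrt (Zen (∑ i, w i)) * Real.sqrt (Wpa (∑ i, w i))) := by
  intro n w Mi M B ε δ hM hε hδ hadm hMi hdisj heff
  have hκ : 0 < kStar := kStar_pos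
  -- per-piece data
  have hZ0 : ∀ i, 0 ≤ Zen (w i) := fun i => integral_nonneg fun x => sq_nonneg _
  have hW0 : ∀ i, 0 ≤ Wpa (w i) := fun i => integral_nonneg fun x => frobeniusNormSq_nonneg _
  have hMi0 : ∀ i, 0 ≤ Mi i := fun i => (norm_nonneg _).trans ((hadm i).2.2.1 0)
  have hJi : ∀ i, |Jst (w i)| ≤ kStar * Mi i * Real.sqrt (Zen (w i)) * Real.sqrt (Wpa (w i)) := fun i =>
    sharpDepletion_is_universal (w i) (Mi i) B (hadm i).1 (hadm i).2.1 (hadm i).2.2.1 (hadm i).2.2.2.1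
      (hadm i).2.2.2.2.1 (hadm i).2.2.2.2.2.1 (hadm i).2.2.2.2.2.2
  -- the masses `gᵢ = √(ZᵢWᵢ) = √Zᵢ √Wᵢ`
  set g : Fin n → ℝ := fun i => Real.sqrt (Zen (w i) * Wpa (w i)) with hg
  have hgi : ∀ i, g i = Real.sqrt (Zen (w i)) * Real.sqrt (Wpa (w i)) := fun i => by
    rw [hg]; exact Real.sqrt_mul (hZ0 i) _
  have hg0 : ∀ i, 0 ≤ g i := fun i => Real.sqrt_nonneg _
  -- additivity and Cauchy–Schwarz: `Σ gᵢ ≤ √Z √W =: G`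
  set G := Real.sqrt (Zen (∑ i, w i)) * Real.sqrt (Wpa (∑ i, w i)) with hG
  have hGsum : ∑ i, g i ≤ G := by
    rw [hG, zen_sum_eq hadm hdisj, wpa_sum_eq hadm hdisj]
    simp_rw [hgi]
    exact Real.sum_sqrt_mul_sqrt_le _ hZ0 hW0
  have hG0 : 0 ≤ G := by rw [hG]; positivity
  -- `|J| ≤ κ⋆ Σ Mᵢ gᵢ`
  have hJsum : |Jst (∑ i, w i)| ≤ kStar * ∑ i, Mi i * g i := by
    rw [jst_sum_eq hadm hdisj, Finset.mul_sum]
    refine (Finset.abs_sum_le_sum_abs _ _).trans (Finset.sum_le_sum fun i _ => ?_)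
    calc |Jst (w i)| ≤ kStar * Mi i * Real.sqrt (Zen (w i)) * Real.sqrt (Wpa (w i)) := hJi i
      _ = kStar * (Mi i * g i) := by rw [hgi]; ring
  -- split the height sum into duds and non-duds
  have hsum_g := Finset.sum_filter_add_sum_filter_not Finset.univ (fun i => Mi i ≤ (1 - δ) * M) g
  have hsum_Mg := Finset.sum_filter_add_sum_filter_not Finset.univ (fun i => Mi i ≤ (1 - δ) * M)
    (fun i => Mi i * g i)
  set D := ∑ i ∈ Finset.univ.filter (fun i => Mi i ≤ (1 - δ) * M), g i with hD
  set D' := ∑ i ∈ Finset.univ.filter (fun i => ¬ (Mi i ≤ (1 - δ) * M)), g i with hD'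
  have h1 : ∑ i ∈ Finset.univ.filter (fun i => Mi i ≤ (1 - δ) * M), Mi i * g i ≤ (1 - δ) * M * D := by
    rw [hD, Finset.mul_sum]
    exact Finset.sum_le_sum fun i hi => mul_le_mul_of_nonneg_right (Finset.mem_filter.1 hi).2 (hg0 i)
  have h2 : ∑ i ∈ Finset.univ.filter (fun i => ¬ (Mi i ≤ (1 - δ) * M)), Mi i * g i ≤ M * D' := by
    rw [hD', Finset.mul_sum]
    exact Finset.sum_le_sum fun i _ => mul_le_mul_of_nonneg_right (hMi i) (hg0 i)
  have hD0 : 0 ≤ D := Finset.sum_nonneg fun i _ => hg0 i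
  have hsplit_M : ∑ i, Mi i * g i ≤ M * (∑ i, g i) - δ * M * D := by
    rw [← hsum_Mg, ← hsum_g]
    linarith [h1, h2]
  -- combine: `(κ⋆−ε) M G ≤ |J| ≤ κ⋆ Σ Mᵢgᵢ ≤ κ⋆ (M G − δ M D)`
  have hA : (kStar - ε) * M * G ≤ |Jst (∑ i, w i)| := by rw [hG, ← mul_assoc]; exact heff
  have hB2 : ∑ i, Mi i * g i ≤ M * G - δ * M * D := by nlinarith [hsplit_M, hGsum, hM]
  have hC : kStar * ∑ i, Mi i * g i ≤ kStar * (M * G - δ * M * D) := mul_le_mul_of_nonneg_left hB2 hκ.le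
  have hchain : (kStar - ε) * M * G ≤ kStar * (M * G - δ * M * D) := by linarith [hJsum]
  -- `κ⋆ δ D ≤ ε G` (divide by `M > 0`)
  have hkey : kStar * δ * D ≤ ε * G := by
    have h3 : M * (kStar * δ * D) ≤ M * (ε * G) := by nlinarith [hchain]
    exact le_of_mul_le_mul_left h3 hM
  rw [div_mul_eq_mul_div, le_div_iff₀ (mul_pos hκ hδ)]
  linarith [hkey]

end DepletionLadder.KStar.BangBang

end Summit.NavierStokesRegularity.NavierStokesRegularity.Theorems

end
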